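import Mathlib.Algebra.Module.SnakeLemma
import Mathlib.Algebra.Module.Submodule.Pointwise
import Mathlib.Algebra.Module.Torsion.Basic
import Mathlib.LinearAlgebra.Quotient.Card
import Mathlib.LinearAlgebra.Isomorphisms
import Mathlib.RingTheory.Ideal.Operations
import Mathlib.SetTheory.Cardinal.Finite
import Literature.NumberTheory.EllipticCurves.IwasawaAlgebraPseudoNullProofs
import HarnessLib

/-!
# Index comparison under a pseudo-isomorphism: `#(N/aN)` versus `#(E/aE)`

D-0014 keeps `Literature/` sorry-free; this sibling of
`Literature.NumberTheory.EllipticCurves.IwasawaAlgebra` declares **theorems only** (no definitions,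
no named facts).

## Content

For a commutative ring `R`, an element `a : R` and an `R`-module `M` we write (informally)
`M/aM` for the quotient `M ⧸ (a • ⊤ : Submodule R M)` (Mathlib's pointwise action of `R` on
`Submodule R M`; `a • ⊤ = Ideal.span {a} • ⊤` by `Submodule.ideal_span_singleton_smul`) and `M[a]`
for the `a`-torsion `Submodule.torsionBy R M a`.  For a short exact sequence
`0 → A -f→ B -g→ C → 0` of `R`-modules the six-term exact sequence of the snake lemma applied to
multiplication by `a`,

`A[a] → B[a] → C[a] -δ→ A/aA → B/aB → C/aC → 0`,

gives the two **index bounds** (Nat.card, with the natural finiteness side conditions)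

* `Module.card_quotient_smul_top_le_mul_of_exact` : `#(B/aB) ≤ #(A/aA) · #(C/aC)`;
* `Module.card_quotient_smul_top_le_card_torsionBy_mul_of_exact` : `#(A/aA) ≤ #(C[a]) · #(B/aB)`
  (the connecting homomorphism is Mathlib's `SnakeLemma.δ'`),

and the corresponding transfers of finiteness.  Splicing the two short exact sequences
`0 → ker φ → N → im φ → 0`, `0 → im φ → E → coker φ → 0` of a linear map `φ : N → E` with
**finite kernel and cokernel** yields, for every `a : R` and with NO further hypothesis
(`Nat.card` of an infinite type is `0`, and finiteness of `N/aN` and `E/aE` is equivalent):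

* `LinearMap.finite_quotient_smul_top_iff_of_finite_ker_coker` : `N/aN` finite `↔` `E/aE` finite;
* `LinearMap.card_quotient_smul_top_le_of_finite_ker_coker` :
  `#(N/aN) ≤ #(ker φ) · #(coker φ) · #(E/aE)`;
* `LinearMap.card_quotient_smul_top_le_of_finite_ker_coker'` : `#(E/aE) ≤ #(coker φ) · #(N/aN)`.

Over the Iwasawa algebra `Λ = ℤ_[p]⟦T⟧` a pseudo-isomorphism between finitely generated modules
has finite kernel and cokernel (tree theorem
`Literature.NumberTheory.EllipticCurves.finite_of_isPseudoNull`), whence the two-sided comparison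
`LinearMap.IsPseudoIsomorphism.exists_card_quotient_le`: there is `B > 0` with
`#(N/aN) ≤ B · #(E/aE)` and `#(E/aE) ≤ B · #(N/aN)` for **every** `a ∈ Λ` (stated in the
`Ideal.span {a} • ⊤` spelling).  This is the standard device by which invariants read off from
specialisations `N/q N` at height-one primes `q = (a)` (e.g. Howard's Eisenstein primes
`q_m = (T^m + p)`, arXiv:1202.6340, proof of Thm 2.2.10; Mazur–Rubin, *Kolyvagin systems*,
§5.3) are transported along the structure theorem `N ∼ ⨁ Λ/(p^{μᵢ}) ⊕ ⨁ Λ/(fⱼ^{nⱼ})`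
(Washington, *Introduction to Cyclotomic Fields*, §13.2).  Finally
`le_of_forall_pow_mul_le` is the elementary exponent comparison used to read a
`μ`-inequality off such asymptotics: if `p^(m·u) ≤ D · p^(m·v)` for all large `m` then `u ≤ v`.

Everything here is folklore module algebra over an arbitrary commutative ring; nothing is specific
to elliptic curves.  Deliberately NOT here: the computation of `#(E/q_m E)` for elementary
modules `E` and the resulting `μ`-inequality criterion (a separate file).
-/

open Function
open scoped Pointwise

namespace Literature.NumberTheory.EllipticCurves

namespace Module

variable {R : Type*} [CommRing R]
  {A B C : Type*} [AddCommGroup A] [_root_.Module R A] [AddCommGroup B] [_root_.Module R B]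
  [AddCommGroup C] [_root_.Module R C]

/-! ### The maps `A/aA → B/aB` induced by linear maps -/

/-- A linear map `g : B → C` carries `aB` into `aC` (`g (a • b) = a • g b`), so it induces a map
`B/aB → C/aC` (`Submodule.mapQ`).
[cite: Washington1997, §13.3 (proof of Thm. 13.13, passage E ∼ Y via the snake lemma)] -/
theorem smul_top_le_comap_smul_top (g : B →ₗ[R] C) (a : R) :
    (a • ⊤ : Submodule R B) ≤ (a • ⊤ : Submodule R C).comap g := by
  intro x hx
  obtain ⟨b, -, rfl⟩ := (Submodule.mem_smul_pointwise_iff_exists x a ⊤).1 hx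
  simp only [Submodule.mem_comap, map_smul]
  exact Submodule.smul_mem_pointwise_smul _ a ⊤ Submodule.mem_top

/-- If `g : B → C` is surjective, so is the induced map `B/aB → C/aC`.
[cite: Washington1997, §13.3 (proof of Thm. 13.13, passage E ∼ Y via the snake lemma)] -/
theorem mapQ_smul_top_surjective (g : B →ₗ[R] C) (hg : Surjective g) (a : R) :
    Surjective (Submodule.mapQ (a • ⊤ : Submodule R B) (a • ⊤ : Submodule R C) g
      (smul_top_le_comap_smul_top g a)) := by
  intro y
  obtain ⟨c, rfl⟩ := Submodule.mkQ_surjective _ y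
  obtain ⟨b, rfl⟩ := hg c
  exact ⟨Submodule.Quotient.mk b, rfl⟩

/-- If `g : B → C` is surjective then `C/aC` is a quotient of `B/aB`; in particular
`#(C/aC) ≤ #(B/aB)` as soon as `B/aB` is finite.
[cite: Washington1997, §13.3 (proof of Thm. 13.13, passage E ∼ Y via the snake lemma)] -/
theorem card_quotient_smul_top_le_of_surjective (g : B →ₗ[R] C) (hg : Surjective g) (a : R)
    [Finite (B ⧸ (a • ⊤ : Submodule R B))] :
    Nat.card (C ⧸ (a • ⊤ : Submodule R C)) ≤ Nat.card (B ⧸ (a • ⊤ : Submodule R B)) :=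
  Nat.card_le_card_of_surjective _ (mapQ_smul_top_surjective g hg a)

/-- If `g : B → C` is surjective and `B/aB` is finite then so is `C/aC`.
[cite: Washington1997, §13.3 (proof of Thm. 13.13, passage E ∼ Y via the snake lemma)] -/
theorem finite_quotient_smul_top_of_surjective (g : B →ₗ[R] C) (hg : Surjective g) (a : R)
    [Finite (B ⧸ (a • ⊤ : Submodule R B))] : Finite (C ⧸ (a • ⊤ : Submodule R C)) :=
  Finite.of_surjective _ (mapQ_smul_top_surjective g hg a)

/-- **Right exactness of `M ↦ M/aM`.** For an exact `A -f→ B -g→ C` with `g` surjective, the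
induced sequence `A/aA → B/aB → C/aC` is exact at `B/aB`: the kernel of `B/aB → C/aC` is the
image of `A/aA → B/aB`.
[cite: Washington1997, §13.3 (proof of Thm. 13.13, passage E ∼ Y via the snake lemma)] -/
theorem ker_mapQ_smul_top_eq_range_mapQ (f : A →ₗ[R] B) (g : B →ₗ[R] C) (hfg : Exact f g)
    (hg : Surjective g) (a : R) :
    LinearMap.ker (Submodule.mapQ (a • ⊤ : Submodule R B) (a • ⊤ : Submodule R C) g
        (smul_top_le_comap_smul_top g a)) =
      LinearMap.range (Submodule.mapQ (a • ⊤ : Submodule R A) (a • ⊤ : Submodule R B) f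
        (smul_top_le_comap_smul_top f a)) := by
  apply le_antisymm
  · intro x hx
    obtain ⟨b, rfl⟩ := Submodule.mkQ_surjective _ x
    rw [LinearMap.mem_ker, Submodule.mkQ_apply, Submodule.mapQ_apply,
      Submodule.Quotient.mk_eq_zero] at hx
    obtain ⟨c, -, hc⟩ := (Submodule.mem_smul_pointwise_iff_exists _ a ⊤).1 hx
    obtain ⟨b', rfl⟩ := hg c
    have hker : g (b - a • b') = 0 := by rw [map_sub, map_smul, hc, sub_self]
    obtain ⟨α, hα⟩ := (hfg (b - a • b')).1 hker
    refine ⟨Submodule.Quotient.mk α, ?_⟩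
    rw [Submodule.mapQ_apply, hα, Submodule.mkQ_apply, Submodule.Quotient.mk_sub]
    have h0 : (Submodule.Quotient.mk (a • b') : B ⧸ (a • ⊤ : Submodule R B)) = 0 :=
      (Submodule.Quotient.mk_eq_zero _).2
        (Submodule.smul_mem_pointwise_smul _ a ⊤ Submodule.mem_top)
    rw [h0, sub_zero]
  · rintro x ⟨y, rfl⟩
    obtain ⟨α, rfl⟩ := Submodule.mkQ_surjective _ y
    rw [LinearMap.mem_ker, Submodule.mkQ_apply, Submodule.mapQ_apply, Submodule.mapQ_apply,
      hfg.apply_apply_eq_zero, Submodule.Quotient.mk_zero]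

/-! ### `#(B/aB) ≤ #(A/aA) · #(C/aC)` -/

/-- For an exact `A -f→ B -g→ C` with `g` surjective:
`#(B/aB) = #(image of A/aA in B/aB) · #(C/aC)` (Lagrange in `B/aB` plus the first isomorphism
theorem for the surjection `B/aB → C/aC`, whose kernel is that image).  `Nat.card`, no finiteness
needed. [cite: Washington1997, §13.3 (proof of Thm. 13.13, passage E ∼ Y via the snake lemma)] -/
theorem card_quotient_smul_top_eq_card_range_mul_of_exact (f : A →ₗ[R] B) (g : B →ₗ[R] C)
    (hfg : Exact f g) (hg : Surjective g) (a : R) :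
    Nat.card (B ⧸ (a • ⊤ : Submodule R B)) =
      Nat.card (LinearMap.range (Submodule.mapQ (a • ⊤ : Submodule R A) (a • ⊤ : Submodule R B)
          f (smul_top_le_comap_smul_top f a))) *
        Nat.card (C ⧸ (a • ⊤ : Submodule R C)) := by
  have hψs := mapQ_smul_top_surjective g hg a
  rw [← ker_mapQ_smul_top_eq_range_mapQ f g hfg hg a,
    Submodule.card_eq_card_quotient_mul_card (LinearMap.ker (Submodule.mapQ
      (a • ⊤ : Submodule R B) (a • ⊤ : Submodule R C) g (smul_top_le_comap_smul_top g a)))]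
  congr 1
  exact Nat.card_congr (LinearMap.quotKerEquivOfSurjective _ hψs).toEquiv

/-- **Index bound, middle term.** For an exact `A -f→ B -g→ C` with `g` surjective and `A/aA`
finite, `#(B/aB) ≤ #(A/aA) · #(C/aC)` (`Nat.card`; if `C/aC` is infinite both sides are `0`).
[cite: Washington1997, §13.3 (proof of Thm. 13.13, passage E ∼ Y via the snake lemma)] -/
theorem card_quotient_smul_top_le_mul_of_exact (f : A →ₗ[R] B) (g : B →ₗ[R] C)
    (hfg : Exact f g) (hg : Surjective g) (a : R) [Finite (A ⧸ (a • ⊤ : Submodule R A))] :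
    Nat.card (B ⧸ (a • ⊤ : Submodule R B)) ≤
      Nat.card (A ⧸ (a • ⊤ : Submodule R A)) * Nat.card (C ⧸ (a • ⊤ : Submodule R C)) := by
  rw [card_quotient_smul_top_eq_card_range_mul_of_exact f g hfg hg a]
  refine Nat.mul_le_mul_right _ ?_
  exact Nat.card_le_card_of_surjective _ (LinearMap.surjective_rangeRestrict _)

/-- **Finiteness transfer, middle term.** For an exact `A -f→ B -g→ C` with `g` surjective, if
`A/aA` and `C/aC` are finite then so is `B/aB`.
[cite: Washington1997, §13.3 (proof of Thm. 13.13, passage E ∼ Y via the snake lemma)] -/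
theorem finite_quotient_smul_top_of_exact (f : A →ₗ[R] B) (g : B →ₗ[R] C)
    (hfg : Exact f g) (hg : Surjective g) (a : R) [Finite (A ⧸ (a • ⊤ : Submodule R A))]
    [Finite (C ⧸ (a • ⊤ : Submodule R C))] : Finite (B ⧸ (a • ⊤ : Submodule R B)) := by
  apply Nat.finite_of_card_ne_zero
  rw [card_quotient_smul_top_eq_card_range_mul_of_exact f g hfg hg a]
  haveI : Finite (LinearMap.range (Submodule.mapQ (a • ⊤ : Submodule R A)
      (a • ⊤ : Submodule R B) f (smul_top_le_comap_smul_top f a))) :=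
    Finite.of_surjective _ (LinearMap.surjective_rangeRestrict _)
  exact Nat.mul_ne_zero Nat.card_pos.ne' Nat.card_pos.ne'

/-! ### `#(A/aA) ≤ #(C[a]) · #(B/aB)` (snake lemma) -/

/-- **The connecting homomorphism.** For a short exact `0 → A -f→ B -g→ C → 0` and `a : R` there
is a linear map `δ : C[a] → A/aA` (the snake-lemma connecting homomorphism for multiplication by
`a`, Mathlib's `SnakeLemma.δ'`: `δ c = [f⁻¹ (a • b)]` for any lift `b` of `c`) whose image is
exactly the kernel of `A/aA → B/aB`.
[cite: Washington1997, §13.3 (proof of Thm. 13.13, passage E ∼ Y via the snake lemma)] -/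
theorem exists_range_eq_ker_mapQ_smul_top (f : A →ₗ[R] B) (g : B →ₗ[R] C) (hf : Injective f)
    (hfg : Exact f g) (hg : Surjective g) (a : R) :
    ∃ δ : Submodule.torsionBy R C a →ₗ[R] A ⧸ (a • ⊤ : Submodule R A),
      LinearMap.range δ = LinearMap.ker (Submodule.mapQ (a • ⊤ : Submodule R A)
        (a • ⊤ : Submodule R B) f (smul_top_le_comap_smul_top f a)) := by
  have h₁ : f.comp (DistribSMul.toLinearMap R A a) = (DistribSMul.toLinearMap R B a).comp f := by
    ext x; simp
  have h₂ : g.comp (DistribSMul.toLinearMap R B a) = (DistribSMul.toLinearMap R C a).comp g := by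
    ext x; simp
  have hι₃ : Exact (Submodule.torsionBy R C a).subtype (DistribSMul.toLinearMap R C a) :=
    LinearMap.exact_subtype_ker_map _
  have hπ₁ : Exact (DistribSMul.toLinearMap R A a) (a • ⊤ : Submodule R A).mkQ := by
    rw [LinearMap.exact_iff, Submodule.ker_mkQ, Submodule.pointwise_smul_def, Submodule.map_top]
  have hπ₂ : Exact (DistribSMul.toLinearMap R B a) (a • ⊤ : Submodule R B).mkQ := by
    rw [LinearMap.exact_iff, Submodule.ker_mkQ, Submodule.pointwise_smul_def, Submodule.map_top]
  refine ⟨SnakeLemma.δ' (DistribSMul.toLinearMap R A a) (DistribSMul.toLinearMap R B a)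
      (DistribSMul.toLinearMap R C a) f g hfg f g hfg h₁ h₂ (Submodule.torsionBy R C a).subtype
      hι₃ (a • ⊤ : Submodule R A).mkQ hπ₁ hg hf, ?_⟩
  have hex := SnakeLemma.exact_δ'_left (DistribSMul.toLinearMap R A a)
    (DistribSMul.toLinearMap R B a) (DistribSMul.toLinearMap R C a) f g hfg f g hfg h₁ h₂
    (Submodule.torsionBy R C a).subtype hι₃ (a • ⊤ : Submodule R A).mkQ hπ₁
    (a • ⊤ : Submodule R B).mkQ hπ₂ hg hf
    (Submodule.mapQ (a • ⊤ : Submodule R A) (a • ⊤ : Submodule R B) f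
      (smul_top_le_comap_smul_top f a))
    (Submodule.mapQ_mkQ _ _ f) (Submodule.mkQ_surjective _)
  exact (LinearMap.exact_iff.1 hex).symm

/-- **Index bound, left term.** For a short exact `0 → A -f→ B -g→ C → 0` with `C[a]` and
`B/aB` finite, `#(A/aA) ≤ #(C[a]) · #(B/aB)`: the kernel of `A/aA → B/aB` is the image of the
connecting homomorphism `C[a] → A/aA`, and the image of `A/aA → B/aB` sits inside `B/aB`.
[cite: Washington1997, §13.3 (proof of Thm. 13.13, passage E ∼ Y via the snake lemma)] -/
theorem card_quotient_smul_top_le_card_torsionBy_mul_of_exact (f : A →ₗ[R] B) (g : B →ₗ[R] C)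
    (hf : Injective f) (hfg : Exact f g) (hg : Surjective g) (a : R)
    [Finite (Submodule.torsionBy R C a)] [Finite (B ⧸ (a • ⊤ : Submodule R B))] :
    Nat.card (A ⧸ (a • ⊤ : Submodule R A)) ≤
      Nat.card (Submodule.torsionBy R C a) * Nat.card (B ⧸ (a • ⊤ : Submodule R B)) := by
  obtain ⟨δ, hδ⟩ := exists_range_eq_ker_mapQ_smul_top f g hf hfg hg a
  set χ := Submodule.mapQ (a • ⊤ : Submodule R A) (a • ⊤ : Submodule R B) f
    (smul_top_le_comap_smul_top f a) with hχ
  rw [Submodule.card_eq_card_quotient_mul_card (LinearMap.ker χ)]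
  refine Nat.mul_le_mul ?_ ?_
  · rw [← hδ]
    exact Nat.card_le_card_of_surjective _ (LinearMap.surjective_rangeRestrict _)
  · rw [Nat.card_congr χ.quotKerEquivRange.toEquiv]
    exact Nat.card_le_card_of_injective _ (LinearMap.range χ).injective_subtype

/-- **Finiteness transfer, left term.** For a short exact `0 → A -f→ B -g→ C → 0`, if `C[a]` and
`B/aB` are finite then so is `A/aA`.
[cite: Washington1997, §13.3 (proof of Thm. 13.13, passage E ∼ Y via the snake lemma)] -/
theorem finite_quotient_smul_top_left_of_exact (f : A →ₗ[R] B) (g : B →ₗ[R] C)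
    (hf : Injective f) (hfg : Exact f g) (hg : Surjective g) (a : R)
    [Finite (Submodule.torsionBy R C a)] [Finite (B ⧸ (a • ⊤ : Submodule R B))] :
    Finite (A ⧸ (a • ⊤ : Submodule R A)) := by
  obtain ⟨δ, hδ⟩ := exists_range_eq_ker_mapQ_smul_top f g hf hfg hg a
  set χ := Submodule.mapQ (a • ⊤ : Submodule R A) (a • ⊤ : Submodule R B) f
    (smul_top_le_comap_smul_top f a) with hχ
  apply Nat.finite_of_card_ne_zero
  rw [Submodule.card_eq_card_quotient_mul_card (LinearMap.ker χ)]
  haveI : Finite (LinearMap.ker χ) := by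
    rw [← hδ]; exact Finite.of_surjective _ (LinearMap.surjective_rangeRestrict _)
  haveI : Finite ((A ⧸ (a • ⊤ : Submodule R A)) ⧸ LinearMap.ker χ) :=
    Finite.of_equiv _ χ.quotKerEquivRange.toEquiv.symm
  exact Nat.mul_ne_zero Nat.card_pos.ne' Nat.card_pos.ne'

end Module

/-! ### Linear maps with finite kernel and cokernel -/

namespace LinearMap

variable {R : Type*} [CommRing R] {N E : Type*} [AddCommGroup N] [_root_.Module R N]
  [AddCommGroup E] [_root_.Module R E]

/-- The short exact sequence `0 → ker φ → N → im φ → 0`.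
[cite: Washington1997, §13.3 (proof of Thm. 13.13, passage E ∼ Y via the snake lemma)] -/
theorem exact_subtype_ker_rangeRestrict (φ : N →ₗ[R] E) :
    Exact (LinearMap.ker φ).subtype φ.rangeRestrict :=
  LinearMap.exact_iff.2 (by rw [LinearMap.ker_rangeRestrict, Submodule.range_subtype])

/-- **Finiteness of `N/aN` and of `E/aE` are equivalent** along a linear map `φ : N → E` with
finite kernel and cokernel (any commutative ring, any `a`).
[cite: Washington1997, §13.3 (proof of Thm. 13.13, passage E ∼ Y via the snake lemma)] -/
theorem finite_quotient_smul_top_iff_of_finite_ker_coker (φ : N →ₗ[R] E)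
    [Finite (LinearMap.ker φ)] [Finite (E ⧸ LinearMap.range φ)] (a : R) :
    Finite (N ⧸ (a • ⊤ : Submodule R N)) ↔ Finite (E ⧸ (a • ⊤ : Submodule R E)) := by
  have hex₁ := exact_subtype_ker_rangeRestrict φ
  have hex₂ := LinearMap.exact_subtype_mkQ (LinearMap.range φ)
  haveI : Finite (Submodule.torsionBy R (E ⧸ LinearMap.range φ) a) :=
    Finite.of_injective _ (Submodule.torsionBy R _ a).injective_subtype
  haveI : Finite ((LinearMap.ker φ) ⧸ (a • ⊤ : Submodule R (LinearMap.ker φ))) :=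
    Finite.of_surjective _ (Submodule.mkQ_surjective _)
  haveI : Finite ((E ⧸ LinearMap.range φ) ⧸ (a • ⊤ : Submodule R (E ⧸ LinearMap.range φ))) :=
    Finite.of_surjective _ (Submodule.mkQ_surjective _)
  constructor
  · intro hN
    haveI := hN
    haveI : Finite ((LinearMap.range φ) ⧸ (a • ⊤ : Submodule R (LinearMap.range φ))) :=
      Module.finite_quotient_smul_top_of_surjective φ.rangeRestrict
        (LinearMap.surjective_rangeRestrict φ) a
    exact Module.finite_quotient_smul_top_of_exact (LinearMap.range φ).subtype
      (LinearMap.range φ).mkQ hex₂ (Submodule.mkQ_surjective _) a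
  · intro hE
    haveI := hE
    haveI : Finite ((LinearMap.range φ) ⧸ (a • ⊤ : Submodule R (LinearMap.range φ))) :=
      Module.finite_quotient_smul_top_left_of_exact (LinearMap.range φ).subtype
        (LinearMap.range φ).mkQ (LinearMap.range φ).injective_subtype hex₂
        (Submodule.mkQ_surjective _) a
    exact Module.finite_quotient_smul_top_of_exact (LinearMap.ker φ).subtype φ.rangeRestrict
      hex₁ (LinearMap.surjective_rangeRestrict φ) a

/-- **Index comparison along a map with finite kernel and cokernel, I.** For `φ : N → E` linear
with `ker φ` and `coker φ = E / im φ` finite and any `a : R`,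
`#(N/aN) ≤ #(ker φ) · #(coker φ) · #(E/aE)` — with no finiteness hypothesis on `N/aN`, `E/aE`
(`Nat.card`; when `E/aE` is infinite so is `N/aN` and both sides vanish).  Proof: splice
`#(N/aN) ≤ #(ker φ / a) · #(im φ / a)` and `#(im φ / a) ≤ #(coker φ [a]) · #(E/aE)`.
[cite: Washington1997, §13.3 (proof of Thm. 13.13, passage E ∼ Y via the snake lemma)] -/
theorem card_quotient_smul_top_le_of_finite_ker_coker (φ : N →ₗ[R] E)
    [Finite (LinearMap.ker φ)] [Finite (E ⧸ LinearMap.range φ)] (a : R) :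
    Nat.card (N ⧸ (a • ⊤ : Submodule R N)) ≤
      Nat.card (LinearMap.ker φ) * Nat.card (E ⧸ LinearMap.range φ) *
        Nat.card (E ⧸ (a • ⊤ : Submodule R E)) := by
  by_cases hE : Finite (E ⧸ (a • ⊤ : Submodule R E))
  · haveI := hE
    have hex₁ := exact_subtype_ker_rangeRestrict φ
    have hex₂ := LinearMap.exact_subtype_mkQ (LinearMap.range φ)
    haveI : Finite (Submodule.torsionBy R (E ⧸ LinearMap.range φ) a) :=
      Finite.of_injective _ (Submodule.torsionBy R _ a).injective_subtype
    haveI : Finite ((LinearMap.ker φ) ⧸ (a • ⊤ : Submodule R (LinearMap.ker φ))) :=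
      Finite.of_surjective _ (Submodule.mkQ_surjective _)
    calc Nat.card (N ⧸ (a • ⊤ : Submodule R N))
        ≤ Nat.card ((LinearMap.ker φ) ⧸ (a • ⊤ : Submodule R (LinearMap.ker φ))) *
            Nat.card ((LinearMap.range φ) ⧸ (a • ⊤ : Submodule R (LinearMap.range φ))) :=
          Module.card_quotient_smul_top_le_mul_of_exact (LinearMap.ker φ).subtype φ.rangeRestrict
            hex₁ (LinearMap.surjective_rangeRestrict φ) a
      _ ≤ Nat.card (LinearMap.ker φ) *
            (Nat.card (Submodule.torsionBy R (E ⧸ LinearMap.range φ) a) *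
              Nat.card (E ⧸ (a • ⊤ : Submodule R E))) :=
          Nat.mul_le_mul (Nat.card_le_card_of_surjective _ (Submodule.mkQ_surjective _))
            (Module.card_quotient_smul_top_le_card_torsionBy_mul_of_exact
              (LinearMap.range φ).subtype (LinearMap.range φ).mkQ
              (LinearMap.range φ).injective_subtype hex₂ (Submodule.mkQ_surjective _) a)
      _ ≤ Nat.card (LinearMap.ker φ) *
            (Nat.card (E ⧸ LinearMap.range φ) * Nat.card (E ⧸ (a • ⊤ : Submodule R E))) :=
          Nat.mul_le_mul_left _ (Nat.mul_le_mul_right _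
            (Nat.card_le_card_of_injective _ (Submodule.torsionBy R _ a).injective_subtype))
      _ = _ := by ring
  · have hN : ¬ Finite (N ⧸ (a • ⊤ : Submodule R N)) :=
      fun h => hE ((finite_quotient_smul_top_iff_of_finite_ker_coker φ a).1 h)
    rw [not_finite_iff_infinite] at hN
    rw [Nat.card_eq_zero_of_infinite]
    exact Nat.zero_le _

/-- **Index comparison along a map with finite kernel and cokernel, II.** For `φ : N → E`
linear with `ker φ` and `coker φ` finite and any `a : R`, `#(E/aE) ≤ #(coker φ) · #(N/aN)`
(`Nat.card`; when `N/aN` is infinite so is `E/aE`).  Proof: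
`#(E/aE) ≤ #(im φ / a) · #(coker φ / a) ≤ #(N/aN) · #(coker φ)`.
[cite: Washington1997, §13.3 (proof of Thm. 13.13, passage E ∼ Y via the snake lemma)] -/
theorem card_quotient_smul_top_le_of_finite_ker_coker' (φ : N →ₗ[R] E)
    [Finite (LinearMap.ker φ)] [Finite (E ⧸ LinearMap.range φ)] (a : R) :
    Nat.card (E ⧸ (a • ⊤ : Submodule R E)) ≤
      Nat.card (E ⧸ LinearMap.range φ) * Nat.card (N ⧸ (a • ⊤ : Submodule R N)) := by
  by_cases hN : Finite (N ⧸ (a • ⊤ : Submodule R N))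
  · haveI := hN
    have hex₂ := LinearMap.exact_subtype_mkQ (LinearMap.range φ)
    haveI : Finite ((LinearMap.range φ) ⧸ (a • ⊤ : Submodule R (LinearMap.range φ))) :=
      Module.finite_quotient_smul_top_of_surjective φ.rangeRestrict
        (LinearMap.surjective_rangeRestrict φ) a
    haveI : Finite ((E ⧸ LinearMap.range φ) ⧸ (a • ⊤ : Submodule R (E ⧸ LinearMap.range φ))) :=
      Finite.of_surjective _ (Submodule.mkQ_surjective _)
    calc Nat.card (E ⧸ (a • ⊤ : Submodule R E))
        ≤ Nat.card ((LinearMap.range φ) ⧸ (a • ⊤ : Submodule R (LinearMap.range φ))) *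
            Nat.card ((E ⧸ LinearMap.range φ) ⧸
              (a • ⊤ : Submodule R (E ⧸ LinearMap.range φ))) :=
          Module.card_quotient_smul_top_le_mul_of_exact (LinearMap.range φ).subtype
            (LinearMap.range φ).mkQ hex₂ (Submodule.mkQ_surjective _) a
      _ ≤ Nat.card (N ⧸ (a • ⊤ : Submodule R N)) * Nat.card (E ⧸ LinearMap.range φ) :=
          Nat.mul_le_mul
            (Module.card_quotient_smul_top_le_of_surjective φ.rangeRestrict
              (LinearMap.surjective_rangeRestrict φ) a)
            (Nat.card_le_card_of_surjective _ (Submodule.mkQ_surjective _))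
      _ = _ := by ring
  · have hE : ¬ Finite (E ⧸ (a • ⊤ : Submodule R E)) :=
      fun h => hN ((finite_quotient_smul_top_iff_of_finite_ker_coker φ a).2 h)
    rw [not_finite_iff_infinite] at hE
    rw [Nat.card_eq_zero_of_infinite]
    exact Nat.zero_le _

/-- The `Ideal.span {a} • ⊤` spelling of
`card_quotient_smul_top_le_of_finite_ker_coker` / `…'`: for `φ : N → E` with finite kernel and
cokernel and every `a : R`, both `#(N/aN) ≤ #(ker φ)·#(coker φ)·#(E/aE)` and
`#(E/aE) ≤ #(coker φ)·#(N/aN)`.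
[cite: Washington1997, §13.3 (proof of Thm. 13.13, passage E ∼ Y via the snake lemma)] -/
theorem card_quotient_span_singleton_smul_top_le_of_finite_ker_coker (φ : N →ₗ[R] E)
    [Finite (LinearMap.ker φ)] [Finite (E ⧸ LinearMap.range φ)] (a : R) :
    Nat.card (N ⧸ (Ideal.span {a} • ⊤ : Submodule R N)) ≤
        Nat.card (LinearMap.ker φ) * Nat.card (E ⧸ LinearMap.range φ) *
          Nat.card (E ⧸ (Ideal.span {a} • ⊤ : Submodule R E)) ∧
      Nat.card (E ⧸ (Ideal.span {a} • ⊤ : Submodule R E)) ≤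
        Nat.card (E ⧸ LinearMap.range φ) *
          Nat.card (N ⧸ (Ideal.span {a} • ⊤ : Submodule R N)) := by
  rw [Submodule.ideal_span_singleton_smul, Submodule.ideal_span_singleton_smul]
  exact ⟨card_quotient_smul_top_le_of_finite_ker_coker φ a,
    card_quotient_smul_top_le_of_finite_ker_coker' φ a⟩

end LinearMap

/-! ### Over the Iwasawa algebra: pseudo-isomorphisms -/

section Iwasawa

variable (p : ℕ) [Fact p.Prime] {N E : Type*} [AddCommGroup N] [Module (IwasawaAlgebra p) N]
  [AddCommGroup E] [Module (IwasawaAlgebra p) E]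

/-- **Index comparison under a pseudo-isomorphism** (Washington, *Introduction to Cyclotomic
Fields*, §13.2: a pseudo-isomorphism of finitely generated `Λ`-modules has finite kernel and
cokernel; Howard, arXiv:1202.6340, proof of Thm 2.2.10 / Mazur–Rubin §5.3 use it to pass
specialised indices along the structure theorem).  If `φ : N → E` is a pseudo-isomorphism of
finitely generated `Λ = ℤ_[p]⟦T⟧`-modules then there is a constant `B > 0` (namely
`#(ker φ) · #(coker φ)`) with `#(N/aN) ≤ B · #(E/aE)` and `#(E/aE) ≤ B · #(N/aN)` for EVERY
`a ∈ Λ` (`Nat.card`, quotients by `Ideal.span {a} • ⊤`; in particular `N/aN` is finite iff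
`E/aE` is). [cite: Washington1997, §13.3 (proof of Thm. 13.13, passage E ∼ Y via the snake lemma)]
[cite: Howard2004HeegnerKolyvagin, Thm. 2.2.10 (proof: 𝔮 = (T^m + p), m → ∞)] -/
theorem LinearMap.IsPseudoIsomorphism.exists_card_quotient_le
    [Module.Finite (IwasawaAlgebra p) N] [Module.Finite (IwasawaAlgebra p) E]
    {φ : N →ₗ[IwasawaAlgebra p] E} (hφ : LinearMap.IsPseudoIsomorphism φ) :
    ∃ B : ℕ, 0 < B ∧ ∀ a : IwasawaAlgebra p,
      Nat.card (N ⧸ (Ideal.span {a} • ⊤ : Submodule (IwasawaAlgebra p) N)) ≤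
          B * Nat.card (E ⧸ (Ideal.span {a} • ⊤ : Submodule (IwasawaAlgebra p) E)) ∧
        Nat.card (E ⧸ (Ideal.span {a} • ⊤ : Submodule (IwasawaAlgebra p) E)) ≤
          B * Nat.card (N ⧸ (Ideal.span {a} • ⊤ : Submodule (IwasawaAlgebra p) N)) := by
  haveI : IsNoetherian (IwasawaAlgebra p) N := isNoetherian_of_isNoetherianRing_of_finite _ _
  obtain ⟨hker, hcoker⟩ := hφ
  haveI : Finite (LinearMap.ker φ) := finite_of_isPseudoNull p (LinearMap.ker φ) hker
  haveI : Finite (E ⧸ LinearMap.range φ) := finite_of_isPseudoNull p (E ⧸ LinearMap.range φ) hcoker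
  refine ⟨Nat.card (LinearMap.ker φ) * Nat.card (E ⧸ LinearMap.range φ),
    Nat.mul_pos Nat.card_pos Nat.card_pos, fun a => ?_⟩
  obtain ⟨h₁, h₂⟩ := LinearMap.card_quotient_span_singleton_smul_top_le_of_finite_ker_coker φ a
  refine ⟨h₁, h₂.trans ?_⟩
  rw [mul_assoc]
  exact Nat.le_mul_of_pos_left _ Nat.card_pos

/-- Pointwise (`a • ⊤`) spelling of `LinearMap.IsPseudoIsomorphism.exists_card_quotient_le`.
[cite: Washington1997, §13.3 (proof of Thm. 13.13, passage E ∼ Y via the snake lemma)] -/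
theorem LinearMap.IsPseudoIsomorphism.exists_card_quotient_smul_top_le
    [Module.Finite (IwasawaAlgebra p) N] [Module.Finite (IwasawaAlgebra p) E]
    {φ : N →ₗ[IwasawaAlgebra p] E} (hφ : LinearMap.IsPseudoIsomorphism φ) :
    ∃ B : ℕ, 0 < B ∧ ∀ a : IwasawaAlgebra p,
      Nat.card (N ⧸ (a • ⊤ : Submodule (IwasawaAlgebra p) N)) ≤
          B * Nat.card (E ⧸ (a • ⊤ : Submodule (IwasawaAlgebra p) E)) ∧
        Nat.card (E ⧸ (a • ⊤ : Submodule (IwasawaAlgebra p) E)) ≤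
          B * Nat.card (N ⧸ (a • ⊤ : Submodule (IwasawaAlgebra p) N)) := by
  obtain ⟨B, hB, h⟩ := hφ.exists_card_quotient_le p
  refine ⟨B, hB, fun a => ?_⟩
  have := h a
  rwa [Submodule.ideal_span_singleton_smul, Submodule.ideal_span_singleton_smul] at this

end Iwasawa

/-! ### Reading an exponent inequality off asymptotics -/

/-- **Exponent comparison.** If `1 < p` and `p^(m·u) ≤ D · p^(m·v)` for all `m ≥ m₀`, then
`u ≤ v` (otherwise `p^m ≤ D` for all large `m`).  This is how a `μ`-inequality
`μ(N) ≤ 2 μ(N')` is read off specialised indices `#(N/q_m N) ≍ p^(m μ(N) + λ(N))`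
(elementary arithmetic; the limiting step `m → ∞` of Howard's Eisenstein-prime argument).
[cite: Howard2004HeegnerKolyvagin, Thm. 2.2.10 (proof: 𝔮 = (T^m + p), m → ∞)] -/
theorem le_of_forall_pow_mul_le {p : ℕ} (hp : 1 < p) {u v D m₀ : ℕ}
    (h : ∀ m, m₀ ≤ m → p ^ (m * u) ≤ D * p ^ (m * v)) : u ≤ v := by
  by_contra huv
  push Not at huv
  -- with `m := max m₀ D` we get `p ^ m ≤ D ≤ m < p ^ m`
  set m := max m₀ D with hm
  have hpm : p ^ (m * v) * p ^ m ≤ p ^ (m * u) := by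
    rw [← pow_add]
    exact Nat.pow_le_pow_right (by omega) (by nlinarith)
  have hle : p ^ (m * v) * p ^ m ≤ p ^ (m * v) * D := by
    calc p ^ (m * v) * p ^ m ≤ p ^ (m * u) := hpm
      _ ≤ D * p ^ (m * v) := h m (le_max_left _ _)
      _ = p ^ (m * v) * D := by ring
  have hD : p ^ m ≤ D := Nat.le_of_mul_le_mul_left hle (by positivity)
  have hlt : D < p ^ m := lt_of_le_of_lt (le_max_right _ _) (Nat.lt_pow_self hp)
  omega

/-- **Exponent comparison, affine form.** If `1 < p` and
`p^(m·u + c) ≤ D · p^(m·v + c')` for all `m ≥ m₀`, then `u ≤ v` (elementary arithmetic).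
[cite: Howard2004HeegnerKolyvagin, Thm. 2.2.10 (proof: 𝔮 = (T^m + p), m → ∞)] -/
theorem le_of_forall_pow_mul_add_le {p : ℕ} (hp : 1 < p) {u v c c' D m₀ : ℕ}
    (h : ∀ m, m₀ ≤ m → p ^ (m * u + c) ≤ D * p ^ (m * v + c')) : u ≤ v := by
  refine le_of_forall_pow_mul_le hp (D := D * p ^ c') (m₀ := m₀) fun m hm => ?_
  have h1 : p ^ (m * u) ≤ p ^ (m * u + c) := Nat.pow_le_pow_right (by omega) (by omega)
  calc p ^ (m * u) ≤ p ^ (m * u + c) := h1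
    _ ≤ D * p ^ (m * v + c') := h m hm
    _ = D * p ^ c' * p ^ (m * v) := by ring

end Literature.NumberTheory.EllipticCurves
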